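import Literature.NumberTheory.Sieve.PrimePlusPowTwoUpperDensity

/-!
# Habsieger–Roblot's `δ`-table for `M = 23205`, kernel-checked over all `23205` classes

[HabsiegerRoblot2006, §3 p. 48]: "Take `M = 23205 = (2^24 − 1)/723`, so that `ω = 24` and `φ(M) = 9216`. … We find
`(δ_M(0), δ_M(1), δ_M(2), δ_M(3)) = (0, 48, 720, 320)`."  Here `δ_M(ν) = |{m ∈ ℤ/Mℤ : |f_M(m)| = ν}|` with
`f_M(m) = {k ∈ ℤ/ωℤ : m − 2^k ∈ (ℤ/Mℤ)^*}` (ibid. p. 47).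

`PrimePlusPowTwoUpperDensity.lean` proves Habsieger–Roblot's bound `d̄ ≤ 0.985049/2` from an explicit LIST `hrS` of the `1088`
classes used on the sieve side, checking only what the bound needs (`Σ ν = 2448` over the list).  This file adds the printed
statement itself, over ALL residue classes: the number of classes `c ∈ hrT` (`= ℤ/3 × ℤ/5 × ℤ/7 × ℤ/13 × ℤ/17 ≅ ℤ/23205`) with
`ν(c) = 0, 1, 2, 3` is `0, 48, 720, 320` (`hr_deltaTable`), and `hrS` is EXACTLY the set of classes with `ν ≤ 3`
(`hrGood_eq_filter`).  The enumeration of the `23205` classes is done by the kernel (`decide +kernel`) on a `Nat.beq`-based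
transcription `hrNuB` of `ν`, proved equal to `hrNu`.

The three kernel enumerations carry `set_option maxHeartbeats 4000000` (the `decide +kernel` pass over the `23205` classes sits
near the default budget on some farm nodes).

NOT a route to Goldbach; documentary (the bound in `PrimePlusPowTwoUpperDensity.lean` does not depend on this file).
-/

namespace Literature.NumberTheory.Sieve.RomanovConstant

/-! ### §1 A kernel-friendly transcription of `ν` -/

/-- Freeness of the class `(a,b,c,d,e)` against one row `f` of the table of powers of `2`, as a `Bool` built from `Nat.beq`
(kernel-accelerated). [cite: HabsiegerRoblot2006, §3 p. 47] -/
def hrFreeB (a b c d e : ℕ) (f : ℕ × ℕ × ℕ × ℕ × ℕ) : Bool :=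
  !(Nat.beq a f.1) && (!(Nat.beq b f.2.1) && (!(Nat.beq c f.2.2.1) && (!(Nat.beq d f.2.2.2.1) && !(Nat.beq e f.2.2.2.2))))

/-- `ν` of the class `(a,b,c,d,e)`, `Bool` transcription. [cite: HabsiegerRoblot2006, §3 p. 47] -/
def hrNuB (a b c d e : ℕ) : ℕ := (hrTab.filter (hrFreeB a b c d e)).length

/-- `decide (m = n) = Nat.beq m n`. [folklore] -/
private theorem decide_eq_eq_beq (m n : ℕ) : decide (m = n) = Nat.beq m n := by
  cases h : Nat.beq m n
  · exact decide_eq_false (Nat.ne_of_beq_eq_false h)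
  · exact decide_eq_true (Nat.eq_of_beq_eq_true h)

/-- `decide (m ≤ n) = Nat.ble m n`. [folklore] -/
private theorem decide_le_eq_ble (m n : ℕ) : decide (m ≤ n) = Nat.ble m n := by
  cases h : Nat.ble m n
  · exact decide_eq_false (Nat.not_le_of_not_ble_eq_true (by rw [h]; exact Bool.false_ne_true))
  · exact decide_eq_true (Nat.le_of_ble_eq_true h)

/-- The transcription is faithful: `hrNu x = hrNuB x₁ x₂ x₃ x₄ x₅`. [folklore] -/
private theorem hrNu_eq_hrNuB (x : ℕ × ℕ × ℕ × ℕ × ℕ) : hrNu x = hrNuB x.1 x.2.1 x.2.2.1 x.2.2.2.1 x.2.2.2.2 := by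
  unfold hrNu hrNuB
  congr 1
  apply List.filter_congr
  intro f _
  simp only [HRFreeT, hrFreeB, Bool.decide_and, decide_not, decide_eq_eq_beq]

/-- The number of classes `(a,b,c,d,e) ∈ [0,3) × [0,5) × [0,7) × [0,13) × [0,17)` whose `ν` satisfies the `Bool` test `q`,
as nested list sums (kernel-evaluable). [folklore] -/
def hrCount (q : ℕ → Bool) : ℕ :=
  ((List.range 3).map fun a => ((List.range 5).map fun b => ((List.range 7).map fun c =>
    ((List.range 13).map fun d => ((List.range 17).map fun e => (q (hrNuB a b c d e)).toNat).sum).sum).sum).sum).sum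

/-- A range sum is the mapped list sum. [folklore] -/
private theorem sum_range_eq_list (n : ℕ) (g : ℕ → ℕ) : ∑ i ∈ Finset.range n, g i = ((List.range n).map g).sum := by
  rw [← List.toFinset_range, List.sum_toFinset _ (List.nodup_range)]

/-- Counting a decidable property over a product of five ranges by nested list sums of a `Bool` transcription. [folklore] -/
private theorem card_filter_prod5 (n₁ n₂ n₃ n₄ n₅ : ℕ) (P : ℕ × ℕ × ℕ × ℕ × ℕ → Prop) [DecidablePred P]
    (g : ℕ → ℕ → ℕ → ℕ → ℕ → Bool) (hg : ∀ a b c d e, decide (P (a, b, c, d, e)) = g a b c d e) :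
    ((Finset.range n₁ ×ˢ Finset.range n₂ ×ˢ Finset.range n₃ ×ˢ Finset.range n₄ ×ˢ Finset.range n₅).filter P).card =
      ((List.range n₁).map fun a => ((List.range n₂).map fun b => ((List.range n₃).map fun c =>
        ((List.range n₄).map fun d => ((List.range n₅).map fun e => (g a b c d e).toNat).sum).sum).sum).sum).sum := by
  rw [Finset.card_filter, Finset.sum_product, sum_range_eq_list]
  congr 1; refine List.map_congr_left fun a _ => ?_
  rw [Finset.sum_product, sum_range_eq_list]
  congr 1; refine List.map_congr_left fun b _ => ?_
  rw [Finset.sum_product, sum_range_eq_list]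
  congr 1; refine List.map_congr_left fun c _ => ?_
  rw [Finset.sum_product, sum_range_eq_list]
  congr 1; refine List.map_congr_left fun d _ => ?_
  rw [sum_range_eq_list]
  congr 1; refine List.map_congr_left fun e _ => ?_
  rw [← hg]
  by_cases h : P (a, b, c, d, e)
  · rw [if_pos h, decide_eq_true h]; rfl
  · rw [if_neg h, decide_eq_false h]; rfl

/-- BRIDGE: a filter of `hrT` by a decidable property of `ν` is counted by `hrCount` of its `Bool` transcription. [folklore] -/
private theorem card_filter_hrT_eq_hrCount (P : ℕ → Prop) [DecidablePred P] (q : ℕ → Bool) (hq : ∀ n, decide (P n) = q n) :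
    (hrT.filter fun x => P (hrNu x)).card = hrCount q := by
  unfold hrT hrCount
  exact card_filter_prod5 3 5 7 13 17 (fun x => P (hrNu x)) (fun a b c d e => q (hrNuB a b c d e))
    fun a b c d e => by rw [← hq, hrNu_eq_hrNuB]

/-! ### §2 The kernel computations -/

set_option maxHeartbeats 4000000 in
/-- KERNEL (all `23205` classes): exactly `1088` classes have `ν ≤ 3`. [cite: HabsiegerRoblot2006, §3 p. 48] -/
theorem hrCount_le_three : hrCount (fun n => Nat.ble n 3) = 1088 := by
  decide +kernel

set_option maxHeartbeats 4000000 in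
/-- KERNEL (the `1088` listed classes): each has `ν ≤ 3`, and `48 / 720 / 320` of them have `ν = 1 / 2 / 3`.
[cite: HabsiegerRoblot2006, §3 p. 48] -/
theorem hrS_nu_profile :
    hrS.all (fun x => Nat.ble (hrNuB x.1 x.2.1 x.2.2.1 x.2.2.2.1 x.2.2.2.2) 3) = true ∧
    (hrS.filter fun x => Nat.beq (hrNuB x.1 x.2.1 x.2.2.1 x.2.2.2.1 x.2.2.2.2) 1).length = 48 ∧
    (hrS.filter fun x => Nat.beq (hrNuB x.1 x.2.1 x.2.2.1 x.2.2.2.1 x.2.2.2.2) 2).length = 720 ∧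
    (hrS.filter fun x => Nat.beq (hrNuB x.1 x.2.1 x.2.2.1 x.2.2.2.1 x.2.2.2.2) 3).length = 320 := by
  refine ⟨?_, ?_, ?_, ?_⟩ <;> decide +kernel

/-! ### §3 Completeness of `hrS` and the printed `δ`-table -/

/-- `hrGood ⊆ {c ∈ hrT : ν(c) ≤ 3}`. [folklore] -/
private theorem hrGood_subset_filter : hrGood ⊆ hrT.filter fun x => hrNu x ≤ 3 := by
  intro x hx
  rw [hrGood, List.mem_toFinset] at hx
  rw [Finset.mem_filter]
  refine ⟨?_, ?_⟩
  · have h := List.all_eq_true.mp hrS_facts.2.1 x hx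
    rw [decide_eq_true_iff] at h
    simp only [hrT, Finset.mem_product, Finset.mem_range]
    exact h
  · have h := List.all_eq_true.mp hrS_nu_profile.1 x hx
    rw [hrNu_eq_hrNuB]
    exact Nat.le_of_ble_eq_true h

/-- **Completeness of the list**: `hrS` (as the finset `hrGood`) is exactly the set of classes modulo `23205` with at most three
free exponents, `{c ∈ hrT : ν(c) ≤ 3}`. [cite: HabsiegerRoblot2006, §3 p. 48] -/
theorem hrGood_eq_filter : hrGood = hrT.filter fun x => hrNu x ≤ 3 := by
  refine Finset.eq_of_subset_of_card_le hrGood_subset_filter ?_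
  rw [card_hrGood, card_filter_hrT_eq_hrCount (fun n => n ≤ 3) (fun n => Nat.ble n 3) fun n => decide_le_eq_ble n 3,
    hrCount_le_three]

/-- For `v ≤ 3`, the classes with `ν = v` are the listed classes with `ν = v`. [folklore] -/
private theorem filter_hrT_eq_filter_hrGood {v : ℕ} (hv : v ≤ 3) :
    (hrT.filter fun x => hrNu x = v) = hrGood.filter fun x => hrNu x = v := by
  rw [hrGood_eq_filter, Finset.filter_filter]
  refine Finset.filter_congr fun x _ => ⟨fun h => ⟨h ▸ hv, h⟩, fun h => h.2⟩

/-- Counting inside the list: `#{x ∈ hrGood : ν(x) = v}` is the length of the corresponding `Bool` filter of `hrS`. [folklore] -/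
private theorem card_filter_hrGood_eq (v : ℕ) :
    (hrGood.filter fun x => hrNu x = v).card =
      (hrS.filter fun x => Nat.beq (hrNuB x.1 x.2.1 x.2.2.1 x.2.2.2.1 x.2.2.2.2) v).length := by
  have hnd : hrS.Nodup := by
    have hp : (hrS.map hrIdx).Pairwise (· < ·) := hrS_facts.2.2.1.pairwise
    rw [List.pairwise_map] at hp
    exact hp.imp fun h => ne_of_apply_ne hrIdx (ne_of_lt h)
  have hc : (hrGood.filter fun x => hrNu x = v) =
      hrS.toFinset.filter fun x => Nat.beq (hrNuB x.1 x.2.1 x.2.2.1 x.2.2.2.1 x.2.2.2.2) v = true :=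
    Finset.filter_congr fun x _ => by rw [hrNu_eq_hrNuB, ← decide_eq_eq_beq]; exact decide_eq_true_iff.symm
  rw [hc, ← List.toFinset_filter, List.toFinset_card_of_nodup (hnd.filter _)]

set_option maxHeartbeats 4000000 in
/-- **Habsieger–Roblot's `δ`-table for `M = 23205`** over all residue classes: `(δ_M(0), δ_M(1), δ_M(2), δ_M(3)) =
(0, 48, 720, 320)`, i.e. no class has all `24` exponents blocked, and `48 / 720 / 320` classes have exactly `1 / 2 / 3` free
exponents `k mod 24`. [cite: HabsiegerRoblot2006, §3 p. 48] -/
theorem hr_deltaTable :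
    (hrT.filter fun x => hrNu x = 0).card = 0 ∧ (hrT.filter fun x => hrNu x = 1).card = 48 ∧
    (hrT.filter fun x => hrNu x = 2).card = 720 ∧ (hrT.filter fun x => hrNu x = 3).card = 320 := by
  refine ⟨?_, ?_, ?_, ?_⟩
  · rw [filter_hrT_eq_filter_hrGood (by norm_num), card_filter_hrGood_eq]
    decide +kernel
  · rw [filter_hrT_eq_filter_hrGood (by norm_num), card_filter_hrGood_eq, hrS_nu_profile.2.1]
  · rw [filter_hrT_eq_filter_hrGood (by norm_num), card_filter_hrGood_eq, hrS_nu_profile.2.2.1]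
  · rw [filter_hrT_eq_filter_hrGood (by norm_num), card_filter_hrGood_eq, hrS_nu_profile.2.2.2]

/-- Consequently `Σ_{c ∈ hrT, ν(c) ≤ 3} ν(c) = 2448 = 1·48 + 2·720 + 3·320`, the numerator of the sieve-side term of
Habsieger–Roblot's bound at `M = 23205` (cf. `sum_hrGood_hrNu`). [cite: HabsiegerRoblot2006, §3 p. 48] -/
theorem sum_filter_hrNu : ∑ c ∈ hrT.filter (fun x => hrNu x ≤ 3), hrNu c = 2448 := by
  rw [← hrGood_eq_filter, sum_hrGood_hrNu]

end Literature.NumberTheory.Sieve.RomanovConstant
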